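import Summits.AtomisticToContinuum.Crystallization.Theses.PalmUnimodularRigidity
import Summits.AtomisticToContinuum.Crystallization.Theorems.MinimiserShells.Negative.LoadBearing
import Summits.AtomisticToContinuum.Crystallization.Theorems.MinimiserShells.Negative.Rootedness
import Summits.AtomisticToContinuum.Crystallization.Theorems.ChargedEnergyGap.Negative.Unconditional
import Summits.AtomisticToContinuum.Crystallization.Theorems.PalmUnimodularRigidityMinimiserShellsEquilibriumInLawShells
import Literature.Probability.Process.PointStationaryLaw
import Literature.MathematicalPhysics.StatisticalMechanics.RootEnergy
import Literature.MathematicalPhysics.StatisticalMechanics.MuGSC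

/-!
# Finite-cluster energy bookkeeping for the cluster-repair argument

Helper file for stub `stub_equilibriumInLaw` (S1) of line `equilibrium-in-law-surgery`, crux
`MinimiserShells` (stmt-AtomisticToContinuum-9225): blueprint lemma 4 (and the algebraic half of
lemma 6).  The energy of a finite cluster `C ⊆ ℝ³` is written as the half double sum
`(∑_{x ∈ C} ∑_{z ∈ C} V_LJ(|x − z|)) / 2` (diagonal terms vanish, `V_LJ(0) = 0`).

* `two_mul_interactionEnergy_eq_sum_sum_image` — for an injective family `R : Fin k → ℝ³`,
  `2 U(R)` is the double sum over its image Finset;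
* `card_mul_eStar_le_half_sum_sum` — periodisation for Finsets: `#C · e* ≤ (∑∑ V)/2`
  (`card_mul_eStar_le` of `ChargedEnergyGap.Negative.Unconditional` on an enumeration);
* `sum_sum_union_biUnion` — bilinear expansion of the double sum over `C₀ ⊔ ⨆_j A_j`;
* `tsum_sdiff_coe_eq_sum_add_tsum` — splitting a field sum over `S ∖ X` (`X ⊆ C ⊆ S` finite)
  into the finite part over `C ∖ X` and the tail over `S ∖ C`;
* `sum_sdiff_eq_sum_add_sum_erase` — `∑_{C ∖ A_j} = ∑_{C₀} + ∑_{i ≠ j} ∑_{A_i}`;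
* `abs_sum_sum_le_of_far` (cross terms between far clusters, `≤ #A #B 16 d⁻⁶`),
  `abs_sum_tsum_sdiff_le` (tails beyond the depth, `≤ #A 250 δ⁻⁴ (R₀ − r)⁻²`) and
  `sum_tsum_sdiff_expand` (the field over `S ∖ X_j` seen from a site, split three ways).
-/

noncomputable section

open MeasureTheory
open scoped ENNReal BigOperators

namespace Summit.AtomisticToContinuum.Crystallization.Theorems.PalmUnimodularRigidityMinimiserShells.EquilibriumInLaw.Cluster

open Literature.Probability.Process (IsPointStationaryLaw IsRootedHardCore count_restrict_singleton_ne_zero_iff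
  map_sub_count_restrict)
open Literature.MathematicalPhysics.StatisticalMechanics (lennardJones IsMuGSC UniformlyDiscrete)
open Summit.AtomisticToContinuum.Crystallization.Theses.PalmUnimodularRigidity (MinimiserShells UnimodularEnergyLowerBound)
open Summit.AtomisticToContinuum.Crystallization.Theorems.MinimiserShells.Negative.LoadBearing
  (eStar meanRootEnergy GoodShell minimiserShells_iff)
open Literature.MathematicalPhysics.StatisticalMechanics (interactionEnergy fieldEnergy
  two_mul_interactionEnergy_eq_sum_sum lennardJones_zero abs_lennardJones_le)
open Summit.AtomisticToContinuum.Crystallization.Theorems.MinimiserShells.Negative.Rootedness (E3)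
open Summit.AtomisticToContinuum.Crystallization.Theorems.ChargedEnergyGapNegative (card_mul_eStar_le)
open Summit.AtomisticToContinuum.Crystallization.Theorems.PalmUnimodularRigidityMinimiserShells.EquilibriumInLaw.Shells
  (tsum_abs_lennardJones_le_of_far)

/-! ## Interaction energy of an injective family as a double sum over its image -/

/-- For an injective family `R : Fin k → ℝ³`, twice its Lennard-Jones interaction energy is the
full double sum over the image Finset (diagonal terms vanish, `V_LJ(0) = 0`). -/
theorem two_mul_interactionEnergy_eq_sum_sum_image {k : ℕ} {R : Fin k → E3}
    (hR : Function.Injective R) :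
    2 * interactionEnergy lennardJones R =
      ∑ x ∈ Finset.univ.image R, ∑ z ∈ Finset.univ.image R, lennardJones (dist x z) := by
  rw [two_mul_interactionEnergy_eq_sum_sum lennardJones lennardJones_zero,
    Finset.sum_image fun _ _ _ _ h => hR h]
  exact Finset.sum_congr rfl fun i _ =>
    (Finset.sum_image (f := fun z => lennardJones (dist (R i) z)) fun _ _ _ _ h => hR h).symm

/-- A sum over `Fin k` of a function of `R i` is the sum over the image Finset (`R` injective). -/
theorem sum_eq_sum_image {k : ℕ} {R : Fin k → E3} (hR : Function.Injective R) (g : E3 → ℝ) :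
    ∑ i, g (R i) = ∑ x ∈ Finset.univ.image R, g x :=
  (Finset.sum_image (f := g) fun _ _ _ _ h => hR h).symm

/-- The image Finset of an injective `R : Fin k → ℝ³` has `k` elements. -/
theorem card_image_of_injective {k : ℕ} {R : Fin k → E3} (hR : Function.Injective R) :
    (Finset.univ.image R).card = k := by
  rw [Finset.card_image_of_injective _ hR, Finset.card_univ, Fintype.card_fin]

/-- The image Finset of `R : Fin k → ℝ³` coerces to `Set.range R`. -/
theorem coe_image_univ {k : ℕ} (R : Fin k → E3) :
    (↑(Finset.univ.image R) : Set E3) = Set.range R := by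
  rw [Finset.coe_image, Finset.coe_univ, Set.image_univ]

/-! ## Periodisation bound for Finsets -/

/-- Twice the interaction energy of the canonical enumeration of a Finset `C` is the double sum
over `C`. -/
theorem two_mul_interactionEnergy_equivFin (C : Finset E3) :
    2 * interactionEnergy lennardJones (fun i => ((C.equivFin.symm i : C) : E3)) =
      ∑ x ∈ C, ∑ z ∈ C, lennardJones (dist x z) := by
  rw [two_mul_interactionEnergy_eq_sum_sum lennardJones lennardJones_zero]
  have inner : ∀ x : E3, ∑ k, lennardJones (dist x ((C.equivFin.symm k : C) : E3)) =
      ∑ z ∈ C, lennardJones (dist x z) := by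
    intro x
    rw [Fintype.sum_equiv C.equivFin.symm (fun k => lennardJones (dist x ((C.equivFin.symm k : C) : E3)))
      (fun c => lennardJones (dist x (c : E3))) (fun _ => rfl)]
    exact Finset.sum_coe_sort C (fun z => lennardJones (dist x z))
  simp_rw [inner]
  rw [Fintype.sum_equiv C.equivFin.symm
    (fun i => ∑ z ∈ C, lennardJones (dist ((C.equivFin.symm i : C) : E3) z))
    (fun c => ∑ z ∈ C, lennardJones (dist (c : E3) z)) (fun _ => rfl)]
  exact Finset.sum_coe_sort C (fun x => ∑ z ∈ C, lennardJones (dist x z))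

/-- **Periodisation for finite clusters.** `#C · e* ≤ (∑_{x ∈ C} ∑_{z ∈ C} V_LJ(|x − z|)) / 2`
for every Finset `C ⊆ ℝ³` (`card_mul_eStar_le` on the canonical enumeration). -/
theorem card_mul_eStar_le_half_sum_sum (C : Finset E3) :
    (C.card : ℝ) * eStar ≤ (∑ x ∈ C, ∑ z ∈ C, lennardJones (dist x z)) / 2 := by
  have hinj : Function.Injective (fun i => ((C.equivFin.symm i : C) : E3)) :=
    fun i j h => C.equivFin.symm.injective (Subtype.val_injective h)
  have h := card_mul_eStar_le hinj
  have h2 := two_mul_interactionEnergy_equivFin C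
  change (C.card : ℝ) * eStar ≤ _ at h
  linarith

/-! ## Bilinear expansion of double sums -/

/-- **Expansion of the double sum over `C₀ ⊔ ⨆_j A_j`.** For a symmetric kernel `f`, a Finset
`C₀` and a finite family `A_j` of Finsets, pairwise disjoint and disjoint from `C₀`:
`∑∑_{C₀ ∪ ⋃A_j} f = ∑∑_{C₀} f + 2 ∑_j ∑_{A_j}∑_{C₀} f + ∑_j ∑∑_{A_j} f + ∑_j ∑_{i ≠ j} ∑_{A_j}∑_{A_i} f`. -/
theorem sum_sum_union_biUnion {m : ℕ} (C₀ : Finset E3) (A : Fin m → Finset E3)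
    (h0 : ∀ j, Disjoint C₀ (A j)) (hA : ∀ j i, j ≠ i → Disjoint (A j) (A i))
    (f : E3 → E3 → ℝ) (hf : ∀ x z, f x z = f z x) :
    ∑ x ∈ C₀ ∪ Finset.univ.biUnion A, ∑ z ∈ C₀ ∪ Finset.univ.biUnion A, f x z =
      ∑ x ∈ C₀, ∑ z ∈ C₀, f x z + 2 * ∑ j, ∑ x ∈ A j, ∑ z ∈ C₀, f x z +
        ∑ j, ∑ x ∈ A j, ∑ z ∈ A j, f x z +
        ∑ j, ∑ i ∈ Finset.univ.erase j, ∑ x ∈ A j, ∑ z ∈ A i, f x z := by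
  set U := Finset.univ.biUnion A with hU
  have hU0 : Disjoint C₀ U := by
    rw [hU, Finset.disjoint_biUnion_right]
    exact fun j _ => h0 j
  have hpd : (↑(Finset.univ : Finset (Fin m)) : Set (Fin m)).PairwiseDisjoint A :=
    fun j _ i _ hji => hA j i hji
  have inner : ∀ x, ∑ z ∈ C₀ ∪ U, f x z = ∑ z ∈ C₀, f x z + ∑ z ∈ U, f x z :=
    fun x => Finset.sum_union hU0
  have overU : ∀ g : E3 → ℝ, ∑ x ∈ U, g x = ∑ j, ∑ x ∈ A j, g x := fun g =>
    Finset.sum_biUnion hpd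
  simp_rw [inner]
  rw [Finset.sum_union hU0, Finset.sum_add_distrib, Finset.sum_add_distrib, overU, overU]
  simp_rw [overU]
  have mixed : ∑ x ∈ C₀, ∑ j, ∑ z ∈ A j, f x z = ∑ j, ∑ x ∈ A j, ∑ z ∈ C₀, f x z := by
    rw [Finset.sum_comm]
    refine Finset.sum_congr rfl fun j _ => ?_
    rw [Finset.sum_comm]
    exact Finset.sum_congr rfl fun x _ => Finset.sum_congr rfl fun z _ => hf _ _
  have diag : ∀ j, ∑ x ∈ A j, ∑ i, ∑ z ∈ A i, f x z =
      ∑ x ∈ A j, ∑ z ∈ A j, f x z + ∑ i ∈ Finset.univ.erase j, ∑ x ∈ A j, ∑ z ∈ A i, f x z := by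
    intro j
    rw [Finset.sum_comm (s := A j) (t := Finset.univ),
      ← Finset.add_sum_erase _ _ (Finset.mem_univ j)]
  rw [mixed]
  simp_rw [diag]
  rw [Finset.sum_add_distrib]
  ring

/-- `∑_{z ∈ C ∖ A_j} g = ∑_{z ∈ C ∖ ⋃A} g + ∑_{i ≠ j} ∑_{z ∈ A_i} g` for a pairwise disjoint family
`A_i ⊆ C`. -/
theorem sum_sdiff_eq_sum_add_sum_erase {m : ℕ} (C : Finset E3) (A : Fin m → Finset E3)
    (hAC : ∀ j, A j ⊆ C) (hA : ∀ j i, j ≠ i → Disjoint (A j) (A i)) (j : Fin m) (g : E3 → ℝ) :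
    ∑ z ∈ C \ A j, g z =
      ∑ z ∈ C \ Finset.univ.biUnion A, g z + ∑ i ∈ Finset.univ.erase j, ∑ z ∈ A i, g z := by
  have hpd : (↑(Finset.univ.erase j) : Set (Fin m)).PairwiseDisjoint A :=
    fun i _ i' _ hii' => hA i i' hii'
  rw [← Finset.sum_biUnion hpd]
  have hdisj : Disjoint (C \ Finset.univ.biUnion A) ((Finset.univ.erase j).biUnion A) := by
    rw [Finset.disjoint_biUnion_right]
    intro i _
    exact Finset.disjoint_left.2 fun z hz hzi =>
      (Finset.mem_sdiff.1 hz).2 (Finset.mem_biUnion.2 ⟨i, Finset.mem_univ i, hzi⟩)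
  rw [← Finset.sum_union hdisj]
  congr 1
  ext z
  simp only [Finset.mem_sdiff, Finset.mem_union, Finset.mem_biUnion, Finset.mem_univ, true_and,
    Finset.mem_erase]
  constructor
  · rintro ⟨hzC, hzj⟩
    by_cases h : ∃ i, z ∈ A i
    · obtain ⟨i, hi⟩ := h
      exact Or.inr ⟨i, ⟨fun hij => hzj (hij ▸ hi), trivial⟩, hi⟩
    · exact Or.inl ⟨hzC, h⟩
  · rintro (⟨hzC, hno⟩ | ⟨i, ⟨hij, -⟩, hi⟩)
    · exact ⟨hzC, fun hzj => hno ⟨j, hzj⟩⟩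
    · exact ⟨hAC i hi, fun hzj => Finset.disjoint_left.1 (hA i j hij) hi hzj⟩

/-! ## Splitting field sums -/

/-- **Splitting a field sum.** For `X ⊆ C ⊆ S` (`X`, `C` finite) and `g` summable over `S ∖ C`:
`∑_{z ∈ S ∖ X} g = ∑_{z ∈ C ∖ X} g + ∑_{z ∈ S ∖ C} g`. -/
theorem tsum_sdiff_coe_eq_sum_add_tsum {S : Set E3} {C X : Finset E3} (hCS : ↑C ⊆ S)
    (hXC : X ⊆ C) (g : E3 → ℝ) (hsum : Summable fun z : ↥(S \ ↑C) => g z) :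
    ∑' z : ↥(S \ ↑X), g z = ∑ z ∈ C \ X, g z + ∑' z : ↥(S \ ↑C), g z := by
  have hsplit : S \ ↑X = ↑(C \ X) ∪ (S \ ↑C) := by
    ext z
    simp only [Set.mem_sdiff, Finset.coe_sdiff, Set.mem_union, Finset.mem_coe]
    constructor
    · rintro ⟨hzS, hzX⟩
      by_cases hzC : z ∈ C
      · exact Or.inl ⟨hzC, hzX⟩
      · exact Or.inr ⟨hzS, hzC⟩
    · rintro (⟨hzC, hzX⟩ | ⟨hzS, hzC⟩)
      · exact ⟨hCS hzC, hzX⟩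
      · exact ⟨hzS, fun hzX => hzC (hXC hzX)⟩
  have hdisj : Disjoint (↑(C \ X) : Set E3) (S \ ↑C) :=
    Set.disjoint_left.2 fun z hz hz' => hz'.2 (Finset.mem_sdiff.1 hz).1
  rw [tsum_congr_set_coe g hsplit, Summable.tsum_union_disjoint hdisj ((C \ X).summable g) hsum,
    Finset.tsum_subtype']

/-! ## The two error bounds -/

/-- **Cross terms between far clusters.** If `A ⊆ B̄(a, r)`, `B ⊆ B̄(b, r)` and
`|a − b| ≥ max (2r + 1) (4r)`, then `|∑_{x ∈ A} ∑_{z ∈ B} V_LJ(|x − z|)| ≤ #A · #B · 16 |a − b|⁻⁶`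
(every pair is at distance `≥ max 1 (|a − b|/2)`, where `|V_LJ| ≤ t⁻⁶/4`). -/
theorem abs_sum_sum_le_of_far (A B : Finset E3) (a b : E3) {r : ℝ}
    (hA : ∀ x ∈ A, dist x a ≤ r) (hB : ∀ z ∈ B, dist z b ≤ r)
    (hd1 : 2 * r + 1 ≤ dist a b) (hd2 : 4 * r ≤ dist a b) :
    |∑ x ∈ A, ∑ z ∈ B, lennardJones (dist x z)| ≤ A.card * B.card * (16 * (dist a b)⁻¹ ^ 6) := by
  have key : ∀ x ∈ A, ∀ z ∈ B, |lennardJones (dist x z)| ≤ 16 * (dist a b)⁻¹ ^ 6 := by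
    intro x hx z hz
    have htri : dist a b ≤ dist a x + dist x z + dist z b := dist_triangle4 a x z b
    rw [dist_comm a x] at htri
    have hr0 : 0 ≤ r := dist_nonneg.trans (hA x hx)
    have h1 : 1 ≤ dist x z := by linarith [hA x hx, hB z hz]
    have h2 : dist a b / 2 ≤ dist x z := by linarith [hA x hx, hB z hz]
    have hab : 0 < dist a b / 2 := by linarith
    calc |lennardJones (dist x z)| ≤ 1 / 4 * (dist x z)⁻¹ ^ 6 := abs_lennardJones_le h1
      _ ≤ 1 / 4 * (dist a b / 2)⁻¹ ^ 6 := by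
          have hi : (dist x z)⁻¹ ≤ (dist a b / 2)⁻¹ := inv_anti₀ hab h2
          have := pow_le_pow_left₀ (inv_nonneg.2 dist_nonneg) hi 6
          linarith
      _ = 16 * (dist a b)⁻¹ ^ 6 := by rw [inv_div]; ring
  calc |∑ x ∈ A, ∑ z ∈ B, lennardJones (dist x z)|
      ≤ ∑ x ∈ A, |∑ z ∈ B, lennardJones (dist x z)| := Finset.abs_sum_le_sum_abs _ _
    _ ≤ ∑ x ∈ A, ∑ z ∈ B, |lennardJones (dist x z)| :=
        Finset.sum_le_sum fun x _ => Finset.abs_sum_le_sum_abs _ _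
    _ ≤ ∑ x ∈ A, ∑ z ∈ B, 16 * (dist a b)⁻¹ ^ 6 :=
        Finset.sum_le_sum fun x hx => Finset.sum_le_sum fun z hz => key x hx z hz
    _ = A.card * B.card * (16 * (dist a b)⁻¹ ^ 6) := by
        simp only [Finset.sum_const, nsmul_eq_mul]
        ring

/-- **Tails beyond the depth.** If `S` is `δ`-separated, `C ⊇ S ∩ B̄(c, R₀)`, `A ⊆ B̄(c, r)` and
`R₀ ≥ r + max 1 δ`, then `|∑_{x ∈ A} ∑_{z ∈ S ∖ C} V_LJ(|x − z|)| ≤ #A · 250 δ⁻⁴ (R₀ − r)⁻²`. -/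
theorem abs_sum_tsum_sdiff_le {S : Set E3} {δ : ℝ} (hδ : 0 < δ)
    (hsep : ∀ x ∈ S, ∀ z ∈ S, x ≠ z → δ ≤ dist x z) (C : Finset E3) {c : E3} {r R₀ : ℝ}
    (hdeep : S ∩ Metric.closedBall c R₀ ⊆ ↑C) (hR₀ : r + max 1 δ ≤ R₀) (A : Finset E3)
    (hA : ∀ x ∈ A, dist x c ≤ r) :
    |∑ x ∈ A, ∑' z : ↥(S \ ↑C), lennardJones (dist x z)| ≤
      A.card * (250 * δ⁻¹ ^ 4 * (R₀ - r)⁻¹ ^ 2) := by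
  have key : ∀ x ∈ A, |∑' z : ↥(S \ ↑C), lennardJones (dist x z)| ≤
      250 * δ⁻¹ ^ 4 * (R₀ - r)⁻¹ ^ 2 := by
    intro x hx
    refine (tsum_abs_lennardJones_le_of_far x hδ (by linarith) (fun z hz => ?_)
      (fun z hz w hw hzw => hsep z hz.1 w hw.1 hzw)).2
    have hfar : R₀ < dist c z := by
      by_contra hle
      exact hz.2 (hdeep ⟨hz.1, Metric.mem_closedBall'.2 (not_lt.1 hle)⟩)
    have := dist_triangle c x z
    rw [dist_comm c x] at this
    linarith [hA x hx]
  calc |∑ x ∈ A, ∑' z : ↥(S \ ↑C), lennardJones (dist x z)|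
      ≤ ∑ x ∈ A, |∑' z : ↥(S \ ↑C), lennardJones (dist x z)| := Finset.abs_sum_le_sum_abs _ _
    _ ≤ ∑ x ∈ A, 250 * δ⁻¹ ^ 4 * (R₀ - r)⁻¹ ^ 2 := Finset.sum_le_sum key
    _ = A.card * (250 * δ⁻¹ ^ 4 * (R₀ - r)⁻¹ ^ 2) := by rw [Finset.sum_const, nsmul_eq_mul]

/-! ## Expanding the field seen by a modification site -/

/-- The field over `S ∖ X_j` seen from a finite set `A` splits into the pairs with
`C₀ = C ∖ ⋃ X_i`, the pairs with the other `X_i`, and the tail over `S ∖ C`. -/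
theorem sum_tsum_sdiff_expand {S : Set E3} {δ : ℝ} (hδ : 0 < δ)
    (hsep : ∀ x ∈ S, ∀ z ∈ S, x ≠ z → δ ≤ dist x z) {m : ℕ} (C : Finset E3) (hCS : ↑C ⊆ S)
    (X : Fin m → Finset E3) (hXC : ∀ j, X j ⊆ C) (hXdisj : ∀ j i, j ≠ i → Disjoint (X j) (X i))
    (C₀ : Finset E3) (hC₀ : C₀ = C \ Finset.univ.biUnion X) (j : Fin m) (A : Finset E3) :
    ∑ x ∈ A, ∑' z : ↥(S \ ↑(X j)), lennardJones (dist x z) =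
      ∑ x ∈ A, ∑ z ∈ C₀, lennardJones (dist x z) +
        ∑ i ∈ Finset.univ.erase j, ∑ x ∈ A, ∑ z ∈ X i, lennardJones (dist x z) +
        ∑ x ∈ A, ∑' z : ↥(S \ ↑C), lennardJones (dist x z) := by
  have hud : UniformlyDiscrete (S \ ↑C) := ⟨δ, hδ, fun x hx z hz hxz => hsep x hx.1 z hz.1 hxz⟩
  have step : ∀ x : E3, ∑' z : ↥(S \ ↑(X j)), lennardJones (dist x z) =
      ∑ z ∈ C₀, lennardJones (dist x z) +
        ∑ i ∈ Finset.univ.erase j, ∑ z ∈ X i, lennardJones (dist x z) +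
        ∑' z : ↥(S \ ↑C), lennardJones (dist x z) := by
    intro x
    rw [tsum_sdiff_coe_eq_sum_add_tsum hCS (hXC j) (fun z => lennardJones (dist x z))
      (hud.summable_lennardJones x), sum_sdiff_eq_sum_add_sum_erase C X hXC hXdisj j, hC₀]
  simp_rw [step]
  rw [Finset.sum_add_distrib, Finset.sum_add_distrib,
    Finset.sum_comm (s := A) (t := Finset.univ.erase j)]

/-- Registered stub marker (helper part 3/14 of `stub_equilibriumInLaw`, line `equilibrium-in-law-surgery`):
periodisation for finite clusters `card_mul_eStar_le_half_sum_sum`, closed form. -/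
theorem stub_equilibriumInLaw_part03 :
    ∀ C : Finset (EuclideanSpace ℝ (Fin 3)), (C.card : ℝ) * eStar ≤ (∑ x ∈ C, ∑ z ∈ C, lennardJones (dist x z)) / 2 :=
  card_mul_eStar_le_half_sum_sum

end Summit.AtomisticToContinuum.Crystallization.Theorems.PalmUnimodularRigidityMinimiserShells.EquilibriumInLaw.Cluster

end
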